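/-
Copyright (c) 2026. All rights reserved.
Released under Apache 2.0 license as described in the file LICENSE.
Authors: abc-iut cell, prover seat abc-iut-w5-d144 (gen 6; row «COR510iv-SB′», brick E input «D1b-TS»), over abc-iut-L4-t3's
`IotaOverTS` / `LamOverLink` add-ons, abc-iut-L4-t5's `logObsFamilyTS`; twin of this seat's `LogFrobeniusObservablesOver.lean`.
-/
import Literature.AnabelianGeometry.AbsoluteAnabelian.DiagramChainFamiliesOver
import Literature.AnabelianGeometry.AbsoluteAnabelian.DiagramOverTransport
import Literature.AnabelianGeometry.AbsoluteAnabelian.Ltimes.LogFrobeniusObservables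
import HarnessLib

/-!
# [AbsTopIII] Cor 5.5 (iii) / Def 5.4 (iv)(vii): the homotopies of the observable `S_log_v` (the `TS`-valued half) lie over `Th•[Z]`

S. Mochizuki, *Topics in absolute anabelian geometry III: global reconstruction algorithms*,
J. Math. Sci. Univ. Tokyo 22 (2015) 939–1156 [MochizukiAbsTopIII2015]; manuscript `paper:url-5493eb38cbb7`: Def 5.4 (iv)
p. 127 ("`λ_{v,ν}` … obtained by composing … with `𝒩⊞_v → 𝒩_v` … lie over `Th•[Z]`"), (vii) p. 128 (the `ι_{v,ε}`), Cor 5.5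
(iii) p. 131 (the observable `S_log_v` on the portion of `D•_{≤3}` indexed by `v`, observation vertex `𝒩_v`), Rmk 3.5.1 p. 78.

The `TS` twin of `LogFrobeniusObservablesOver.lean`.  The observable's diagram `(D•_{≤3})_v ∪ {𝒩_v}` (`logDiagramTS v`) LIES
OVER `Th•[Z] = ℰ•` through `𝒳_⋎, □ ↦ proj`, `𝒩⊞_w ↦ (𝒩⊞_w → 𝒩_w → Th•[Z])`, `𝒩_v ↦ (𝒩_v → Th•[Z])`, the arrows lying over by
`logOver`, the unitor, `lamOver w ν` and — for the observation arrow `𝒩⊞_v → 𝒩_v` — the identity (`logTSOverE v`).  With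
respect to it:

* `isOver_logGenHomTS` — GIVEN abc-iut-L4-t3's add-ons `IotaOverTS T` (the `TS`-valued `ι_{v,ε}` lie over `Th•[Z]`) and
  `LamOverLink`, both printed kinds of generator pairs of `S_log_v` (abc-iut-L4-t5's `LogGenTS.pre` / `.post`, homotopy
  `logGenHomTS`) carry OVER-homotopies;
* `isOver_logObsFamilyTS_η` — ★ hence EVERY homotopy of abc-iut-L4-t5's constructed `logObsFamilyTS v T hsqTS` lies over
  `Th•[Z]` (this seat's `isOver_chainFamily_η`): the hypothesis «hoverTS» of the Cor 5.10 (iv)(b) compatibility closer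
  (row «COR510iv-SB′», abc-iut-f-101's brick D2) in over-datum form; `_map` over any category under `Th•[Z]`.

Interface-level (hypotheses `IotaOverTS`, `LamOverLink`, `IotaSquaresCommuteTS`; no carrier); nothing here bears on
[IUTchIII] Cor. 3.12; no side taken; typed ≠ proved.

**`⋉`-TWIN (cell row «LTIMES-SUCCESSOR», L4-lead m162; typing finding T3g9-F1).**  This file is the verbatim
re-elaboration of `LogFrobeniusObservablesTSOver.lean` over the successor interface `LogFrobeniusSettingLtimes`
(`Ltimes/LogFrobeniusCompatibility.lean`: `ι⊞_{v,ε}` indexed by the edges of `Γ⃗^⋉_v` at EVERY place, [AbsTopIII] Cor 5.5 (iii)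
p. 131), produced by the cell recipe `LTIMES-RECIPE.md`: names carry over inside `namespace LogFrobeniusSettingLtimes`, the
section variable is `Lt`, setting-independent declarations are NOT repeated (the originals are in scope), statements and
proofs are otherwise unchanged.  The original file over the frozen interface stays as it is.
SLICE T9 «LTIMES-OBSERVABLES» (abc-iut-f-101 gen 6): THIS TWIN CARRIES ONLY §1 — the over-`Th•[Z]` datum `logTSOverE`
(`tsN`, `tsμ`, `tsμObs`) consumed by the bridge `Ltimes/LogFrobeniusMonoTelecoreObservablesOverBridgeTS`; the bookkeeping, the
`IotaOverTS` component lemmas, the structure isomorphisms along the generator paths and the over-ness of the generator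
homotopies (`isOver_logGenHomTS`, `isOver_logObsFamilyTS_η(_map)`; they need the `⋉`-twins of `LamOverLink` and of the
`TS`-observables trunk `…TSMoves/…TSCoherence/…TSOfIotaSquare`) belong to the E-style instance slice and are NOT re-elaborated here.
-/

universe u

open CategoryTheory Quiver

namespace Literature.AnabelianGeometry.AbsoluteAnabelian

namespace LogFrobeniusSettingLtimes

variable {Vmod : Type u} {isArc : Vmod → Bool} (Lt : LogFrobeniusSettingLtimes Vmod isArc) (v : Vmod)

/-! ## The `TS`-observable's diagram over `Th•[Z]` -/

/-- Structure functor of a vertex of the portion `(D•_{≤3})_v` towards `Th•[Z]`: `𝒳_⋎, □ ↦ proj`, `𝒩⊞_w ↦ 𝒩⊞_w → 𝒩_w → Th•[Z]`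
(the other vertices do not occur). [cite: MochizukiAbsTopIII2015, Remark 3.5.1 p.78] -/
def tsN : (x : DVertex Vmod isArc) → InPortionThree v x → (x.categoryLtimes Lt ⥤ Lt.E)
  | .row1 _, _ => Lt.proj
  | .core, _ => Lt.proj
  | .nplus w, _ => Lt.forget w ⋙ Lt.toE w
  | .nv _, h => absurd h (by rintro (h | h) <;> [exact absurd h.2 (by change ¬ (4 ≤ 2); decide); cases h])
  | .e5, h => absurd h (by rintro (h | h) <;> [exact absurd h.2 (by change ¬ (5 ≤ 2); decide); cases h])
  | .an, h => absurd h (by rintro (h | h) <;> [exact absurd h.2 (by change ¬ (6 ≤ 2); decide); cases h])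
  | .e7, h => absurd h (by rintro (h | h) <;> [exact absurd h.2 (by change ¬ (7 ≤ 2); decide); cases h])
  | .nmonoPlus _, h => absurd h (by rintro (h | h) <;> [exact h.1.elim; cases h])
  | .nmono _, h => absurd h (by rintro (h | h) <;> [exact h.1.elim; cases h])
  | .emono5, h => absurd h (by rintro (h | h) <;> [exact h.1.elim; cases h])
  | .anMono, h => absurd h (by rintro (h | h) <;> [exact h.1.elim; cases h])
  | .emono7, h => absurd h (by rintro (h | h) <;> [exact h.1.elim; cases h])

/-- The arrows of the portion lie over `Th•[Z]`: `log` by `logOver`, `id_⋎` by the unitor, `λ⊞_{w,ν}` by `lamOver w ν`.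
[cite: MochizukiAbsTopIII2015, Def 5.4 (iv) p. 127] -/
def tsμ : ∀ {x y : DVertex Vmod isArc} (e : DEdge isArc x y) (hx : InPortionThree v x) (hy : InPortionThree v y),
    DEdge.functorLtimes Lt e ⋙ Lt.tsN v y hy ≅ Lt.tsN v x hx
  | _, _, .log _, _, _ => Lt.logOver
  | _, _, .toCore _, _, _ => Lt.proj.leftUnitor
  | _, _, .lam w ν _, _, _ => Lt.lamOver w ν
  | _, _, .forget _, _, hy => absurd hy (by rintro (h | h) <;> [exact absurd h.2 (by change ¬ (4 ≤ 2); decide); cases h])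
  | _, _, .toE _, hx, _ => absurd hx (by rintro (h | h) <;> [exact absurd h.2 (by change ¬ (4 ≤ 2); decide); cases h])
  | _, _, .κAn, hx, _ => absurd hx (by rintro (h | h) <;> [exact absurd h.2 (by change ¬ (5 ≤ 2); decide); cases h])
  | _, _, .anToE, hx, _ => absurd hx (by rintro (h | h) <;> [exact absurd h.2 (by change ¬ (6 ≤ 2); decide); cases h])
  | _, _, .monoNplus _, _, hy => absurd hy (by rintro (h | h) <;> [exact h.1.elim; cases h])
  | _, _, .monoN _, hx, _ => absurd hx (by rintro (h | h) <;> [exact absurd h.2 (by change ¬ (4 ≤ 2); decide); cases h])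
  | _, _, .monoE5, hx, _ => absurd hx (by rintro (h | h) <;> [exact absurd h.2 (by change ¬ (5 ≤ 2); decide); cases h])
  | _, _, .monoAn, hx, _ => absurd hx (by rintro (h | h) <;> [exact absurd h.2 (by change ¬ (6 ≤ 2); decide); cases h])
  | _, _, .monoE7, hx, _ => absurd hx (by rintro (h | h) <;> [exact absurd h.2 (by change ¬ (7 ≤ 2); decide); cases h])
  | _, _, .forgetMono _, hx, _ => absurd hx (by rintro (h | h) <;> [exact h.1.elim; cases h])
  | _, _, .toEmono _, hx, _ => absurd hx (by rintro (h | h) <;> [exact h.1.elim; cases h])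
  | _, _, .κAnMono, hx, _ => absurd hx (by rintro (h | h) <;> [exact h.1.elim; cases h])
  | _, _, .anMonoToE, hx, _ => absurd hx (by rintro (h | h) <;> [exact h.1.elim; cases h])

/-- The observation arrow `𝒩⊞_v → 𝒩_v` lies over `Th•[Z]` by the identity. [cite: MochizukiAbsTopIII2015, Def 5.4 (iv) p. 127] -/
def tsμObs : ∀ {x : DVertex Vmod isArc} (i : DEdge isArc x (.nv v)) (hx : InPortionThree v x),
    DEdge.functorLtimes Lt i ⋙ Lt.toE v ≅ Lt.tsN v x hx
  | _, .forget _, _ => Iso.refl _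

/-- **The `TS`-observable's diagram `(D•_{≤3})_v ∪ {𝒩_v}` over `Th•[Z]`** (abc-iut-L4-t12's `OverData`).
[cite: MochizukiAbsTopIII2015, Remark 3.5.1 p.78] -/
def logTSOverE : (Lt.logDiagramTS v).OverData Lt.E where
  N a := match a with
    | ExtVertex.base a => Lt.tsN v a.1 a.2
    | ExtVertex.obs => Lt.toE v
  μ {a b} e := match a, b, e with
    | ExtVertex.base a, ExtVertex.base b, e => Lt.tsμ v e a.2 b.2
    | ExtVertex.base a, ExtVertex.obs, i => Lt.tsμObs v i a.2
    | ExtVertex.obs, ExtVertex.base _, j => PEmpty.elim j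
    | ExtVertex.obs, ExtVertex.obs, e => PEmpty.elim e

/-- The structure functor at the observation vertex is `𝒩_v → Th•[Z]`. [cite: MochizukiAbsTopIII2015, Remark 3.5.1 p.78] -/
@[simp] theorem logTSOverE_N_obs : (Lt.logTSOverE v).N (logShapeTS (isArc := isArc) v).obs = Lt.toE v := rfl

/-- The over-isomorphism of `λ⊞_{v,ν}` is `lamOver v ν`. [cite: MochizukiAbsTopIII2015, Def 5.4 (iv) p. 127] -/
@[simp] theorem logTSOverE_μ_lamEdgeTS (ν : LogVertex (isArc v)) (hν : ν.isPostLog = false) :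
    (Lt.logTSOverE v).μ (lamEdgeTS v ν hν) = Lt.lamOver v ν := rfl

/-- The over-isomorphism of `𝒩⊞_v → 𝒩_v` is the identity. [cite: MochizukiAbsTopIII2015, Def 5.4 (iv) p. 127] -/
@[simp] theorem logTSOverE_μ_forgetEdgeTS : (Lt.logTSOverE v).μ (forgetEdgeTS (isArc := isArc) v) = Iso.refl _ := rfl

/-- The over-isomorphism of `id_⋎` is the unitor. [cite: MochizukiAbsTopIII2015, Cor 5.5 p. 130] -/
@[simp] theorem logTSOverE_μ_toCoreEdgeTS (n : ℤ) : (Lt.logTSOverE v).μ (toCoreEdgeTS v n) = Lt.proj.leftUnitor := rfl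

/-- The over-isomorphism of `log` is `logOver`. [cite: MochizukiAbsTopIII2015, Def 5.4 (ii) p. 125] -/
@[simp] theorem logTSOverE_μ_logEdgeTS (n : ℤ) : (Lt.logTSOverE v).μ (logEdgeTS v n) = Lt.logOver := rfl

end LogFrobeniusSettingLtimes

end Literature.AnabelianGeometry.AbsoluteAnabelian
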